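import Literature.AnabelianGeometry.SemiGraphs.ArithLevelKerCongruenceTreeLevels
import Literature.AnabelianGeometry.SemiGraphs.ArithThm54CapstonesChartOfProducers
import HarnessLib

/-!
# [SemiAnbd] Prop 5.2 (i)/(iv) / Thm 5.4 producer T54-B — the continuity binder `hK1′` at the tree levels of the
# chart of a COFINAL GALOIS TOWER with characteristic levels, REDUCED to congruence-continuity (`hCC`) and
# self-normalisation (`hself`): the generic-tower twin of abc-iut-w6-d117's canonical-tower reduction (proof-only)

Mochizuki, *Semi-graphs of anabelioids*, Publ. RIMS **42** (2006) 221–322, §5 Def 5.1 (i)(c)/(d) p. 62, Prop 5.2 (i)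
p. 63, Prop 5.2 (iv) p. 64; §3 proof of Thm 3.7 (iii) p. 41 (the trees `𝒢_{∞,i}`), Prop 3.6 p. 38 ("independent, up
to inner automorphism, of the choice of the cofinal system") [cite: MochizukiSemiAnbd2006, Prop 5.2 (iv), p. 64].

PROOF-ONLY file (abc-iut cell, layer L3, sub-DAG `plan/L3/SUBDAG-SemiAnbd-Thm54.md`, producer row T54-B =
`plan/GAP-LEDGER.md` G-w4d053-1; row «T54·COROLLARY-INTEGRATOR», seat abc-iut-w4-d089 gen 6; the producer of
record of «T54·hK1′» is abc-iut-w6-d117).  No definition, no new named fact.  abc-iut-w6-d117's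
`ArithLevelKerCongruenceTreeLevels.lean` reduces the capstone binder `hK1′ : ∀ n, IsOpen (aug (levelKer (ker ρ_n)))`
to `hself` (vertex-group images self-normalising at deep levels) ∧ `hCC` (congruence-continuity of the outer action at
deep tree levels, trivial base action nearby) — §2 there
(`SemiGraph.SubgroupPresentation.isOpen_map_levelKer_of_congruent_lifts_of_isTree`, resp.
`isOpen_map_levelKer_outerSemidirectProductSnd_of_congruenceContinuous` at the outer model over ANY chart) is generic,
§3 instantiates it at the CANONICAL tower `𝒢.galoisLevelData h36`.  The integrated Thm 5.4 line of this seat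
(`arithMaximalCompactStatement_outerAction_piPresentation_chart_of_producers_levelTopology`, p437233;
`arithThm54_outerModels_chart_of_producers`, p439824) lives at the chart `D.chart …` of an ARBITRARY cofinal Galois
tower `D` with CHARACTERISTIC finite levels (`hker`), where the tree-level stability is abc-iut-L3-t9's
`(hKst_and_hLst_of_ker_piLevelAut_eq_charOpenCore …).1`.  Here §2 is instantiated THERE, in exactly that currency:

* `GaloisLevelData.hK1'_chart_at_of_congruenceContinuous_of_hself` — `hK1′` at ONE tree level `n` of `D` ⟸
  `hself n` ∧ `hCC n` (tree-ness of the coset level = `piPresentation_hT`, no hypothesis);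
* `GaloisLevelData.hK1'_chart_of_eventually_congruenceContinuous_of_hself` — `hK1′` at ALL tree levels (the binder
  text of p437233 / p439824 VERBATIM) ⟸ `hself` and `hCC` at all DEEP levels `n ≥ n₀` (antitone level kernels:
  abc-iut-L3-d4's `levelKer_mono`, `ker_projAut_anti`; abc-iut-L3-d2's `TemperedExtension.isOpen_map_of_frequently`).

HONEST LABEL (as abc-iut-w6-d117's): a REDUCTION — `hCC` is Def 5.1 (i)(c)/(d) + Prop 5.2 (i) at the deep tree
levels (DESIGN), `hself` is expected from total elevation + compactness + cofinality but NOT proved (it fails at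
shallow levels); the finite-monodromy regime needs neither (abc-iut-w6-d117's `ArithLevelKerOpenOfFiniteMonodromy`).
Nothing here refers to the IUT corpus; no side is taken on [IUTchIII] Cor. 3.12; typed ≠ proved for the residual
inputs.
-/

namespace Literature.AnabelianGeometry.SemiGraphs

namespace ProfiniteSemiGraph

namespace GaloisLevelData

open CategoryTheory Topology Filter
open Literature.AnabelianGeometry.EtaleTheta

universe u w

variable {𝒢 : ProfiniteSemiGraph.{u}} (D : GaloisLevelData 𝒢) (h𝒢 : 𝒢.IsCountable)
  (hcof : ∀ (T : CovObj 𝒢), T.IsTempered → ∀ p : T.Point,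
    ∃ i : ℕ, ∀ j, i ≤ j → (D.S j).Splits (T.component p))
  (hcn : 𝒢.graph.IsConnected) (hS : ∀ n, (D.S n).Splits (D.S n)) (hfin : ∀ n, (D.S n).IsFinite)
  (hne : ∀ n, (D.S n).HasNonemptyFibres)
  (hconn : ∀ (n : ℕ) (p q : (D.S n).Point), (D.S n).SameComponent p q)
  {PA : Type w} [Group PA] [TopologicalSpace PA] [ContinuousMul PA]
  (ρ' : PA →* TopOut (D.chart h𝒢 hcof hcn hS hfin hne).G) (baseAct : PA →* Aut 𝒢.graph)
  (T : ∀ w : 𝒢.graph.Vertex, D.PointSeq h𝒢 w) (R : SemiGraph.RefBranches 𝒢.graph)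
  (hP : (D.piPresentation h𝒢 T R).IsArithCompatible
    (((contMulAut (D.chart h𝒢 hcof hcn hS hfin hne).G).subtype.comp
      (MonoidHom.fst (contMulAut (D.chart h𝒢 hcof hcn hS hfin hne).G) PA)).comp (outerSemidirectProduct ρ').subtype)
    (baseAct.comp (outerSemidirectProductSnd ρ')))
  (d : ℕ → ℕ) (hker : ∀ n, (D.piLevelAut h𝒢 hconn n).ker = charOpenCore (D.temperedPi h𝒢) (d n))

/-- **`hK1′` at ONE tree level `n` of the chart of a cofinal Galois tower with characteristic levels ⟸
`hself n` ∧ `hCC n`** (abc-iut-w6-d117's reduction, §2 of `ArithLevelKerCongruenceTreeLevels.lean`, at `D.chart …`;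
tree-ness of the coset level `ker ρ_n` = `piPresentation_hT`). [cite: MochizukiSemiAnbd2006, Prop 5.2 (iv), p. 64] -/
theorem hK1'_chart_at_of_congruenceContinuous_of_hself (hG : 𝒢.graph.IsGraph) (n : ℕ)
    (hself : ∀ (w : 𝒢.graph.Vertex) (q : (D.chart h𝒢 hcof hcn hS hfin hne).G ⧸ (D.projAut h𝒢 n).ker),
      (∀ x : (D.chart h𝒢 hcof hcn hS hfin hne).G ⧸ (D.projAut h𝒢 n).ker,
        x ∈ ((D.piPresentation h𝒢 T R).H w).map (QuotientGroup.mk' _) ↔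
        q⁻¹ * x * q ∈ ((D.piPresentation h𝒢 T R).H w).map (QuotientGroup.mk' _)) →
      q ∈ ((D.piPresentation h𝒢 T R).H w).map (QuotientGroup.mk' _))
    (hCC : ∃ U ∈ 𝓝 (1 : PA), ∀ a ∈ U, baseAct a = 1 ∧
      ∃ φ : contMulAut (D.chart h𝒢 hcof hcn hS hfin hne).G, TopOut.mk (D.chart h𝒢 hcof hcn hS hfin hne).G φ = ρ' a ∧
        ∀ y : (D.chart h𝒢 hcof hcn hS hfin hne).G, (φ : MulAut (D.chart h𝒢 hcof hcn hS hfin hne).G) y * y⁻¹ ∈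
          (D.projAut h𝒢 n).ker) :
    IsOpen ((((D.piPresentation h𝒢 T R).levelKer hP (D.projAut h𝒢 n).ker
        ((D.hKst_and_hLst_of_ker_piLevelAut_eq_charOpenCore h𝒢 hconn T R ρ' hP d hker).1 n)).map
          (outerSemidirectProductSnd ρ') : Subgroup PA) : Set PA) :=
  isOpen_map_levelKer_outerSemidirectProductSnd_of_congruenceContinuous (D.chart h𝒢 hcof hcn hS hfin hne) ρ' baseAct
    _ hP _ _ (MonoidHom.normal_ker _) (D.piPresentation_hT h𝒢 T R n) hG hself hCC

/-- **The binder `hK1′` of the integrated Thm 5.4 line (ALL tree levels of the chart of a cofinal Galois tower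
with characteristic levels) ⟸ `hself` and congruence-continuity `hCC` at all DEEP levels `n ≥ n₀`** (antitone
arithmetic level kernels, openness inherited downwards). [cite: MochizukiSemiAnbd2006, Prop 5.2 (iv), p. 64] -/
theorem hK1'_chart_of_eventually_congruenceContinuous_of_hself (hG : 𝒢.graph.IsGraph) (n₀ : ℕ)
    (hself : ∀ n, n₀ ≤ n → ∀ (w : 𝒢.graph.Vertex)
      (q : (D.chart h𝒢 hcof hcn hS hfin hne).G ⧸ (D.projAut h𝒢 n).ker),
      (∀ x : (D.chart h𝒢 hcof hcn hS hfin hne).G ⧸ (D.projAut h𝒢 n).ker,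
        x ∈ ((D.piPresentation h𝒢 T R).H w).map (QuotientGroup.mk' _) ↔
        q⁻¹ * x * q ∈ ((D.piPresentation h𝒢 T R).H w).map (QuotientGroup.mk' _)) →
      q ∈ ((D.piPresentation h𝒢 T R).H w).map (QuotientGroup.mk' _))
    (hCC : ∀ n, n₀ ≤ n → ∃ U ∈ 𝓝 (1 : PA), ∀ a ∈ U, baseAct a = 1 ∧
      ∃ φ : contMulAut (D.chart h𝒢 hcof hcn hS hfin hne).G, TopOut.mk (D.chart h𝒢 hcof hcn hS hfin hne).G φ = ρ' a ∧
        ∀ y : (D.chart h𝒢 hcof hcn hS hfin hne).G, (φ : MulAut (D.chart h𝒢 hcof hcn hS hfin hne).G) y * y⁻¹ ∈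
          (D.projAut h𝒢 n).ker) :
    ∀ n, IsOpen ((((D.piPresentation h𝒢 T R).levelKer hP (D.projAut h𝒢 n).ker
        ((D.hKst_and_hLst_of_ker_piLevelAut_eq_charOpenCore h𝒢 hconn T R ρ' hP d hker).1 n)).map
          (outerSemidirectProductSnd ρ') : Subgroup PA) : Set PA) := by
  refine TemperedExtension.isOpen_map_of_frequently (outerSemidirectProductSnd ρ')
    (fun n => (D.piPresentation h𝒢 T R).levelKer hP (D.projAut h𝒢 n).ker
      ((D.hKst_and_hLst_of_ker_piLevelAut_eq_charOpenCore h𝒢 hconn T R ρ' hP d hker).1 n))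
    (fun m n hmn => ?_) (fun n => ?_)
  · exact (D.piPresentation h𝒢 T R).levelKer_mono hP _ _ (D.ker_projAut_anti h𝒢 hmn)
  · exact ⟨max n n₀, le_max_left _ _,
      D.hK1'_chart_at_of_congruenceContinuous_of_hself h𝒢 hcof hcn hS hfin hne hconn ρ' baseAct T R hP d hker hG
        (max n n₀) (hself _ (le_max_right _ _)) (hCC _ (le_max_right _ _))⟩

end GaloisLevelData

end ProfiniteSemiGraph

end Literature.AnabelianGeometry.SemiGraphs
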